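import Summits.ResolutionOfSingularities.ResolutionOfSingularities.Theorems.FrobeniusLadderFInjectiveMacaulayficationT11PlusOriginTransport
import Summits.ResolutionOfSingularities.ResolutionOfSingularities.Theorems.FrobeniusLadderFInjectiveMacaulayficationT4PlusPrime
import Summits.ResolutionOfSingularities.ResolutionOfSingularities.Theorems.FrobeniusLadderFInjectiveMacaulayficationT4SpecimenDoor
import Summits.ResolutionOfSingularities.ResolutionOfSingularities.Theorems.FrobeniusLadderFInjectiveMacaulayficationQuotientOriginMaximal
import HarnessLib

/-!
# I12: THE ORIGIN STALKS OF THE C.I. MODEL `T⁽⁴⁾⁺` AND OF THE HYPERSURFACE `T⁽⁴⁾` ARE ISOMORPHIC; `PFix` MOVES ACROSS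
# (crux `FrobeniusLadder.FInjectiveMacaulayfication` stmt-ResolutionOfSingularities-15315, chain w45a, road B; res-L1-w45a-plan-1 R12.36 «I12 = the
# T⁽⁴⁾ twin of I11»; seat res-L1-w45a-stub-2)

[OURS · L1 W4.5a] AI-written; AI review is weaker than expert review. NOT a statement of any manuscript; no named fact.

`T⁽⁴⁾⁺ = Spec k[x,y,z,w,v,Φ]/(F₀, F₁)`, `F₀ = Φ − y² − x³`, `F₁ = z² + Φ³ + w⁷ + v⁸ + x¹²` (`(x,y,z,w,v,Φ) = (X 0,…,X 5)`, conventions of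
`T4PlusPrime` / `T4PlusOffStratum` / `T4SpecimenDoor`), and `T⁽⁴⁾ = Spec k[x,y,z,w,v]/(g)`, `g = z² + (y²+x³)³ + w⁷ + v⁸ + x¹²`
(`T4HypersurfacePrime`, `Gs 0 = g`). The twin of `T11PlusOriginTransport` / `T11PlusOriginTransportStalk` (I11, p520355 + p521228 + p522144),
same proofs with `Fin 6 / Fin 5` and the key variable `X 5`: eliminating `Φ ↦ y² + x³` is a ring isomorphism of the coordinate rings
(`exists_quotEquiv`, over `T4PlusPrime.span_pair_eq_comap₆`) matching the origin ideals (`quotEquiv_mem_origin_iff`), hence isomorphisms of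
the local rings at the origins (`nonempty_originLocalization_ringEquiv`, `nonempty_originStalk_ringEquiv` via `Spec.stalkIso`), and `PFix_p`
(text VERBATIM as in `PointFixableOfCert.pointFixable_of_ciCert` / `PointFixableTransport.pointFixable_of_ringEquiv`) moves across:

* `t4Plus_h0_of_hypersurface` — `PFix(𝒪_{T⁽⁴⁾,0}) → PFix(𝒪_{T⁽⁴⁾⁺,0})` (stalk to stalk, maximality of the two origin ideals as binders);
* `t4Plus_h0_of_localization` — from `PFix(Localization.AtPrime 𝔪_{T⁽⁴⁾,0})` to the hypothesis `h0` of
  `T4SpecimenDoor.fInjectiveMacaulayfication_T4plus_char7` (stub-4, p520610) VERBATIM (`∀ b`, `b.asIdeal =` origin ideal `→ PFix(𝒪_b)`);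
* `t4Plus_h0_of_hypersurface_h0` — (3′) STALK-FORM BRIDGE: hypothesis = the conclusion of the road-B frame `RoadBFrame.originPointFixable_of_hon`
  VERBATIM at `n = 5` with `Gs` for `![f]`, conclusion = the door's `h0` VERBATIM; any field, any `p` (the door takes `p := 7`).

* `fInjectiveMacaulayfication_T4plus_char7_of_frame` — ASSEMBLY ENDPOINT: `h_frame` (the frame's output on `T⁽⁴⁾`, `p = 7`) ⊢ the crux
  conclusion for `T⁽⁴⁾⁺/7` (= `T4SpecimenDoor.fInjectiveMacaulayfication_T4plus_char7 k Fs hF₀ hF₁ (t4Plus_h0_of_hypersurface_h0 k 7 Fs hF₀ hF₁ ![g] hg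
  h_frame)`, the origin-prime instance from `QuotientOriginMaximal.isMaximal_span_range_mk_X`).

No definitions, no named facts. [folklore]
-/

set_option linter.dupNamespace false

noncomputable section

open MvPolynomial AlgebraicGeometry

namespace Summit.ResolutionOfSingularities.ResolutionOfSingularities.Theorems.FInjectiveMacaulayfication.T4PlusOriginTransport

open Summit.ResolutionOfSingularities.ResolutionOfSingularities.Theorems.FInjectiveMacaulayfication

variable (k : Type) [Field k]

/-! ## The elimination map `φ : k[x,y,z,w,v,Φ] → k[x,y,z,w,v]`, `Φ ↦ y² + x³`, and the section `ι` -/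

/-- Such a `φ` exists. [folklore] -/
theorem exists_phi : ∃ φ : MvPolynomial (Fin 6) k →ₐ[k] MvPolynomial (Fin 5) k,
    (∀ i : Fin 5, φ (X i.castSucc) = X i) ∧ φ (X 5) = X 1 ^ 2 + X 0 ^ 3 :=
  ⟨MvPolynomial.aeval (Fin.snoc (fun i : Fin 5 => (X i : MvPolynomial (Fin 5) k)) (X 1 ^ 2 + X 0 ^ 3)),
    fun i => by rw [MvPolynomial.aeval_X, Fin.snoc_castSucc],
    by rw [MvPolynomial.aeval_X, show (5 : Fin 6) = Fin.last 5 from rfl, Fin.snoc_last]⟩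

/-- `φ ∘ ι = id` for `ι = rename castSucc`. [folklore] -/
theorem phi_rename (φ : MvPolynomial (Fin 6) k →ₐ[k] MvPolynomial (Fin 5) k)
    (hφ : ∀ i : Fin 5, φ (X i.castSucc) = X i) (q : MvPolynomial (Fin 5) k) : φ (MvPolynomial.rename Fin.castSucc q) = q := by
  have h : φ.comp (MvPolynomial.rename Fin.castSucc) = AlgHom.id k _ :=
    MvPolynomial.algHom_ext fun i => by rw [AlgHom.comp_apply, MvPolynomial.rename_X, hφ, AlgHom.id_apply]
  exact DFunLike.congr_fun h q

/-- `φ` is surjective. [folklore] -/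
theorem phi_surjective (φ : MvPolynomial (Fin 6) k →ₐ[k] MvPolynomial (Fin 5) k)
    (hφ : ∀ i : Fin 5, φ (X i.castSucc) = X i) : Function.Surjective φ := fun q => ⟨_, phi_rename k φ hφ q⟩

/-- `ι ∘ φ = ψ`, the substitution `Φ ↦ y² + x³` of `T4PlusPrime` (`ψ`). [folklore] -/
theorem rename_phi (φ : MvPolynomial (Fin 6) k →ₐ[k] MvPolynomial (Fin 5) k)
    (hφ : ∀ i : Fin 5, φ (X i.castSucc) = X i) (hφ5 : φ (X 5) = X 1 ^ 2 + X 0 ^ 3)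
    (q : MvPolynomial (Fin 6) k) : MvPolynomial.rename Fin.castSucc (φ q) =
    MvPolynomial.aeval (R := k) (fun i : Fin 6 => if i = 5 then (X 1 ^ 2 + X 0 ^ 3 : MvPolynomial (Fin 6) k) else X i) q := by
  have h : (MvPolynomial.rename (R := k) Fin.castSucc).comp φ =
      MvPolynomial.aeval (R := k) (fun i : Fin 6 => if i = 5 then (X 1 ^ 2 + X 0 ^ 3 : MvPolynomial (Fin 6) k) else X i) :=
    MvPolynomial.algHom_ext fun i => by
      rw [AlgHom.comp_apply, MvPolynomial.aeval_X]
      by_cases hi : i = 5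
      · subst hi
        rw [hφ5, if_pos rfl]
        simp only [map_add, map_pow, MvPolynomial.rename_X]
        rfl
      · rw [if_neg hi]
        obtain ⟨j, rfl⟩ : ∃ j : Fin 5, Fin.castSucc j = i := by
          have : (i : ℕ) < 5 := by
            have := i.isLt
            have hne : (i : ℕ) ≠ 5 := fun h => hi (Fin.ext h)
            omega
          exact ⟨⟨i, this⟩, Fin.ext rfl⟩
        rw [hφ, MvPolynomial.rename_X]
  exact DFunLike.congr_fun h q

/-- `φ ∘ ψ = φ`. [folklore] -/
theorem phi_substKey (φ : MvPolynomial (Fin 6) k →ₐ[k] MvPolynomial (Fin 5) k)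
    (hφ : ∀ i : Fin 5, φ (X i.castSucc) = X i) (hφ5 : φ (X 5) = X 1 ^ 2 + X 0 ^ 3) (q : MvPolynomial (Fin 6) k) :
    φ (MvPolynomial.aeval (R := k) (fun i : Fin 6 => if i = 5 then (X 1 ^ 2 + X 0 ^ 3 : MvPolynomial (Fin 6) k) else X i) q) = φ q := by
  rw [← rename_phi k φ hφ hφ5 q, phi_rename k φ hφ]

/-- `φ (g₆) = g₅` for the hypersurface equation written in six resp. five variables. [folklore] -/
theorem phi_g (φ : MvPolynomial (Fin 6) k →ₐ[k] MvPolynomial (Fin 5) k)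
    (hφ : ∀ i : Fin 5, φ (X i.castSucc) = X i) : φ (X 2 ^ 2 + (X 1 ^ 2 + X 0 ^ 3) ^ 3 + X 3 ^ 7 + X 4 ^ 8 + X 0 ^ 12) =
    (X 2 ^ 2 + (X 1 ^ 2 + X 0 ^ 3) ^ 3 + X 3 ^ 7 + X 4 ^ 8 + X 0 ^ 12 : MvPolynomial (Fin 5) k) := by
  have h0 := hφ 0; have h1 := hφ 1; have h2 := hφ 2; have h3 := hφ 3; have h4 := hφ 4
  simp only [Fin.castSucc_zero, Fin.castSucc_one] at h0 h1
  rw [show (Fin.castSucc (2 : Fin 5) : Fin 6) = 2 from rfl] at h2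
  rw [show (Fin.castSucc (3 : Fin 5) : Fin 6) = 3 from rfl] at h3
  rw [show (Fin.castSucc (4 : Fin 5) : Fin 6) = 4 from rfl] at h4
  simp only [map_add, map_pow, h0, h1, h2, h3, h4]

/-- `ι (g₅) = g₆`. [folklore] -/
theorem rename_g : MvPolynomial.rename (R := k) Fin.castSucc (X 2 ^ 2 + (X 1 ^ 2 + X 0 ^ 3) ^ 3 + X 3 ^ 7 + X 4 ^ 8 + X 0 ^ 12 : MvPolynomial (Fin 5) k) =
    (X 2 ^ 2 + (X 1 ^ 2 + X 0 ^ 3) ^ 3 + X 3 ^ 7 + X 4 ^ 8 + X 0 ^ 12 : MvPolynomial (Fin 6) k) := by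
  simp only [map_add, map_pow, MvPolynomial.rename_X]
  rfl

/-- **The kernel of `k[x,y,z,w,v,Φ] → k[x,y,z,w,v]/(g)` is `(F₀, F₁)`.** [folklore] -/
theorem mem_span_pair_iff (φ : MvPolynomial (Fin 6) k →ₐ[k] MvPolynomial (Fin 5) k)
    (hφ : ∀ i : Fin 5, φ (X i.castSucc) = X i) (hφ5 : φ (X 5) = X 1 ^ 2 + X 0 ^ 3) (F₀ F₁ : MvPolynomial (Fin 6) k)
    (hF₀ : F₀ = X 5 - X 1 ^ 2 - X 0 ^ 3) (hF₁ : F₁ = X 2 ^ 2 + X 5 ^ 3 + X 3 ^ 7 + X 4 ^ 8 + X 0 ^ 12) (q : MvPolynomial (Fin 6) k) :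
    q ∈ Ideal.span ({F₀, F₁} : Set (MvPolynomial (Fin 6) k)) ↔
      φ q ∈ Ideal.span ({X 2 ^ 2 + (X 1 ^ 2 + X 0 ^ 3) ^ 3 + X 3 ^ 7 + X 4 ^ 8 + X 0 ^ 12} : Set (MvPolynomial (Fin 5) k)) := by
  rw [T4PlusPrime.span_pair_eq_comap₆ k F₀ F₁ _ hF₀ hF₁ rfl, Ideal.mem_comap]
  change MvPolynomial.aeval (R := k) (fun i : Fin 6 => if i = 5 then (X 1 ^ 2 + X 0 ^ 3 : MvPolynomial (Fin 6) k) else X i) q ∈ _ ↔ _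
  constructor
  · intro h
    obtain ⟨r, hr⟩ := Ideal.mem_span_singleton'.mp h
    rw [← phi_substKey k φ hφ hφ5 q, ← hr, map_mul, phi_g k φ hφ]
    exact Ideal.mem_span_singleton'.mpr ⟨_, rfl⟩
  · intro h
    obtain ⟨r, hr⟩ := Ideal.mem_span_singleton'.mp h
    rw [← rename_phi k φ hφ hφ5 q, ← hr, map_mul, rename_g k]
    exact Ideal.mem_span_singleton'.mpr ⟨_, rfl⟩

/-- **THE COORDINATE RINGS OF `T⁽⁴⁾⁺` AND `T⁽⁴⁾` ARE ISOMORPHIC** by `Φ ↦ y² + x³` (any field). [folklore] -/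
theorem exists_quotEquiv (Fs : Fin 2 → MvPolynomial (Fin 6) k)
    (hF₀ : Fs 0 = X 5 - X 1 ^ 2 - X 0 ^ 3) (hF₁ : Fs 1 = X 2 ^ 2 + X 5 ^ 3 + X 3 ^ 7 + X 4 ^ 8 + X 0 ^ 12)
    (Gs : Fin 1 → MvPolynomial (Fin 5) k) (hG : Gs 0 = X 2 ^ 2 + (X 1 ^ 2 + X 0 ^ 3) ^ 3 + X 3 ^ 7 + X 4 ^ 8 + X 0 ^ 12)
    (φ : MvPolynomial (Fin 6) k →ₐ[k] MvPolynomial (Fin 5) k)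
    (hφ : ∀ i : Fin 5, φ (X i.castSucc) = X i) (hφ5 : φ (X 5) = X 1 ^ 2 + X 0 ^ 3) :
    ∃ e : (MvPolynomial (Fin 6) k ⧸ Ideal.span (Set.range Fs)) ≃+* (MvPolynomial (Fin 5) k ⧸ Ideal.span (Set.range Gs)),
      ∀ q : MvPolynomial (Fin 6) k, e (Ideal.Quotient.mk (Ideal.span (Set.range Fs)) q) =
        Ideal.Quotient.mk (Ideal.span (Set.range Gs)) (φ q) := by
  set f : MvPolynomial (Fin 6) k →ₐ[k] (MvPolynomial (Fin 5) k ⧸ Ideal.span (Set.range Gs)) :=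
    (Ideal.Quotient.mkₐ k (Ideal.span (Set.range Gs))).comp φ with hf
  have hfq : ∀ q, f q = Ideal.Quotient.mk (Ideal.span (Set.range Gs)) (φ q) := fun q => rfl
  have hsurj : Function.Surjective f :=
    (Ideal.Quotient.mkₐ_surjective k _).comp (phi_surjective k φ hφ)
  have hGs : Ideal.span (Set.range Gs) = Ideal.span {(X 2 ^ 2 + (X 1 ^ 2 + X 0 ^ 3) ^ 3 + X 3 ^ 7 + X 4 ^ 8 + X 0 ^ 12 : MvPolynomial (Fin 5) k)} := by
    rw [T11PlusOriginTransport.range_fin_one, hG]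
  have hker : Ideal.span (Set.range Fs) = RingHom.ker f.toRingHom := by
    ext q
    rw [RingHom.mem_ker, AlgHom.toRingHom_eq_coe, AlgHom.coe_toRingHom, hfq, Ideal.Quotient.eq_zero_iff_mem, hGs,
      T11PlusOriginTransport.range_fin_two,
      ← mem_span_pair_iff k φ hφ hφ5 (Fs 0) (Fs 1) hF₀ hF₁ q]
  refine ⟨(Ideal.quotEquivOfEq hker).trans (Ideal.quotientKerAlgEquivOfSurjective hsurj).toRingEquiv, fun q => ?_⟩
  rw [RingEquiv.trans_apply, Ideal.quotEquivOfEq_mk]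
  exact (Ideal.quotientKerAlgEquivOfSurjective_apply hsurj _).trans (Ideal.kerLiftAlg_mk f q)

/-- The isomorphism matches the ORIGIN ideals. [folklore] -/
theorem quotEquiv_mem_origin_iff (Fs : Fin 2 → MvPolynomial (Fin 6) k) (Gs : Fin 1 → MvPolynomial (Fin 5) k)
    (φ : MvPolynomial (Fin 6) k →ₐ[k] MvPolynomial (Fin 5) k)
    (hφ : ∀ i : Fin 5, φ (X i.castSucc) = X i) (hφ5 : φ (X 5) = X 1 ^ 2 + X 0 ^ 3)
    (e : (MvPolynomial (Fin 6) k ⧸ Ideal.span (Set.range Fs)) ≃+* (MvPolynomial (Fin 5) k ⧸ Ideal.span (Set.range Gs)))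
    (he : ∀ q : MvPolynomial (Fin 6) k, e (Ideal.Quotient.mk (Ideal.span (Set.range Fs)) q) =
        Ideal.Quotient.mk (Ideal.span (Set.range Gs)) (φ q)) (x : MvPolynomial (Fin 6) k ⧸ Ideal.span (Set.range Fs)) :
    e x ∈ Ideal.span (Set.range fun i : Fin 5 => Ideal.Quotient.mk (Ideal.span (Set.range Gs)) (MvPolynomial.X i)) ↔
      x ∈ Ideal.span (Set.range fun i : Fin 6 => Ideal.Quotient.mk (Ideal.span (Set.range Fs)) (MvPolynomial.X i)) := by
  -- the image of the origin ideal of `T⁽⁴⁾⁺` is the origin ideal of `T⁽⁴⁾`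
  have hmap : Ideal.map e (Ideal.span (Set.range fun i : Fin 6 => Ideal.Quotient.mk (Ideal.span (Set.range Fs)) (MvPolynomial.X i))) =
      Ideal.span (Set.range fun i : Fin 5 => Ideal.Quotient.mk (Ideal.span (Set.range Gs)) (MvPolynomial.X i)) := by
    apply le_antisymm
    · rw [Ideal.map_span, Ideal.span_le]
      rintro _ ⟨_, ⟨i, rfl⟩, rfl⟩
      show e (Ideal.Quotient.mk (Ideal.span (Set.range Fs)) (MvPolynomial.X i)) ∈ _
      rw [he]
      by_cases hi : i = 5
      · subst hi
        rw [hφ5, map_add, map_pow, map_pow]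
        have h1 : Ideal.Quotient.mk (Ideal.span (Set.range Gs)) (MvPolynomial.X 1) ∈
            Ideal.span (Set.range fun i : Fin 5 => Ideal.Quotient.mk (Ideal.span (Set.range Gs)) (MvPolynomial.X i)) :=
          Ideal.subset_span ⟨1, rfl⟩
        have h0 : Ideal.Quotient.mk (Ideal.span (Set.range Gs)) (MvPolynomial.X 0) ∈
            Ideal.span (Set.range fun i : Fin 5 => Ideal.Quotient.mk (Ideal.span (Set.range Gs)) (MvPolynomial.X i)) :=
          Ideal.subset_span ⟨0, rfl⟩
        exact Ideal.add_mem _ (Ideal.pow_mem_of_mem _ h1 2 two_pos) (Ideal.pow_mem_of_mem _ h0 3 (by norm_num))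
      · obtain ⟨j, rfl⟩ : ∃ j : Fin 5, Fin.castSucc j = i := by
          have hne : (i : ℕ) ≠ 5 := fun h => hi (Fin.ext h)
          have := i.isLt
          exact ⟨⟨i, by omega⟩, Fin.ext rfl⟩
        rw [hφ]
        exact Ideal.subset_span ⟨j, rfl⟩
    · rw [Ideal.span_le]
      rintro _ ⟨j, rfl⟩
      show Ideal.Quotient.mk (Ideal.span (Set.range Gs)) (MvPolynomial.X j) ∈ _
      rw [show Ideal.Quotient.mk (Ideal.span (Set.range Gs)) (MvPolynomial.X j) =
        e (Ideal.Quotient.mk (Ideal.span (Set.range Fs)) (MvPolynomial.X j.castSucc)) from by rw [he, hφ]]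
      exact Ideal.mem_map_of_mem _ (Ideal.subset_span ⟨j.castSucc, rfl⟩)
  constructor
  · intro h
    rw [← hmap, ← Ideal.comap_symm, Ideal.mem_comap] at h
    simpa using h
  · intro h
    rw [← hmap]
    exact Ideal.mem_map_of_mem _ h

/-- **THE LOCAL RINGS OF `T⁽⁴⁾⁺` AND `T⁽⁴⁾` AT THE ORIGINS ARE ISOMORPHIC** (`Localization.AtPrime` form). [folklore] -/
theorem nonempty_originLocalization_ringEquiv (Fs : Fin 2 → MvPolynomial (Fin 6) k)
    (hF₀ : Fs 0 = X 5 - X 1 ^ 2 - X 0 ^ 3) (hF₁ : Fs 1 = X 2 ^ 2 + X 5 ^ 3 + X 3 ^ 7 + X 4 ^ 8 + X 0 ^ 12)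
    (Gs : Fin 1 → MvPolynomial (Fin 5) k) (hG : Gs 0 = X 2 ^ 2 + (X 1 ^ 2 + X 0 ^ 3) ^ 3 + X 3 ^ 7 + X 4 ^ 8 + X 0 ^ 12)
    [hCI : (Ideal.span (Set.range fun i : Fin 6 => Ideal.Quotient.mk (Ideal.span (Set.range Fs)) (MvPolynomial.X i))).IsPrime]
    [hH : (Ideal.span (Set.range fun i : Fin 5 => Ideal.Quotient.mk (Ideal.span (Set.range Gs)) (MvPolynomial.X i))).IsPrime] :
    Nonempty (Localization.AtPrime (Ideal.span (Set.range fun i : Fin 6 => Ideal.Quotient.mk (Ideal.span (Set.range Fs)) (MvPolynomial.X i))) ≃+*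
      Localization.AtPrime (Ideal.span (Set.range fun i : Fin 5 => Ideal.Quotient.mk (Ideal.span (Set.range Gs)) (MvPolynomial.X i)))) := by
  obtain ⟨φ, hφ, hφ5⟩ := exists_phi k
  obtain ⟨e, he⟩ := exists_quotEquiv k Fs hF₀ hF₁ Gs hG φ hφ hφ5
  exact BlowupFiModelOfCover.nonempty_ringEquiv_localization_of_ringEquiv e _ _
    (fun x => quotEquiv_mem_origin_iff k Fs Gs φ hφ hφ5 e he x)

/-- **THE STALKS OF `Spec` AT THE ORIGINS ARE ISOMORPHIC** (scheme form, via `Spec.stalkIso`). [folklore] -/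
theorem nonempty_originStalk_ringEquiv (Fs : Fin 2 → MvPolynomial (Fin 6) k)
    (hF₀ : Fs 0 = X 5 - X 1 ^ 2 - X 0 ^ 3) (hF₁ : Fs 1 = X 2 ^ 2 + X 5 ^ 3 + X 3 ^ 7 + X 4 ^ 8 + X 0 ^ 12)
    (Gs : Fin 1 → MvPolynomial (Fin 5) k) (hG : Gs 0 = X 2 ^ 2 + (X 1 ^ 2 + X 0 ^ 3) ^ 3 + X 3 ^ 7 + X 4 ^ 8 + X 0 ^ 12)
    (h𝔪CI : (Ideal.span (Set.range fun i : Fin 6 => Ideal.Quotient.mk (Ideal.span (Set.range Fs)) (MvPolynomial.X i))).IsMaximal)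
    (h𝔪H : (Ideal.span (Set.range fun i : Fin 5 => Ideal.Quotient.mk (Ideal.span (Set.range Gs)) (MvPolynomial.X i))).IsMaximal) :
    Nonempty ((Spec (.of (MvPolynomial (Fin 6) k ⧸ Ideal.span (Set.range Fs)))).presheaf.stalk
        (⟨Ideal.span (Set.range fun i : Fin 6 => Ideal.Quotient.mk (Ideal.span (Set.range Fs)) (MvPolynomial.X i)), h𝔪CI.isPrime⟩ :
          PrimeSpectrum (MvPolynomial (Fin 6) k ⧸ Ideal.span (Set.range Fs))) ≃+*
      (Spec (.of (MvPolynomial (Fin 5) k ⧸ Ideal.span (Set.range Gs)))).presheaf.stalk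
        (⟨Ideal.span (Set.range fun i : Fin 5 => Ideal.Quotient.mk (Ideal.span (Set.range Gs)) (MvPolynomial.X i)), h𝔪H.isPrime⟩ :
          PrimeSpectrum (MvPolynomial (Fin 5) k ⧸ Ideal.span (Set.range Gs)))) := by
  haveI := h𝔪CI.isPrime
  haveI := h𝔪H.isPrime
  obtain ⟨eL⟩ := nonempty_originLocalization_ringEquiv k Fs hF₀ hF₁ Gs hG
  exact ⟨((Spec.stalkIso (.of (MvPolynomial (Fin 6) k ⧸ Ideal.span (Set.range Fs)))
      ⟨Ideal.span (Set.range fun i : Fin 6 => Ideal.Quotient.mk (Ideal.span (Set.range Fs)) (MvPolynomial.X i)), h𝔪CI.isPrime⟩).commRingCatIsoToRingEquiv.trans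
      eL).trans
    (Spec.stalkIso (.of (MvPolynomial (Fin 5) k ⧸ Ideal.span (Set.range Gs)))
      ⟨Ideal.span (Set.range fun i : Fin 5 => Ideal.Quotient.mk (Ideal.span (Set.range Gs)) (MvPolynomial.X i)), h𝔪H.isPrime⟩).commRingCatIsoToRingEquiv.symm⟩

/-- **`h0` OF THE SPECIMEN DOOR FROM THE ROAD-B INSTANCE**: `PFix(𝒪_{T⁽⁴⁾, 0}) → PFix(𝒪_{T⁽⁴⁾⁺, 0})` (any field `k`, any `p`; `PFix` text
VERBATIM as in `PointFixableOfCert.pointFixable_of_ciCert`). [folklore] -/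
theorem t4Plus_h0_of_hypersurface (p : ℕ) (Fs : Fin 2 → MvPolynomial (Fin 6) k)
    (hF₀ : Fs 0 = X 5 - X 1 ^ 2 - X 0 ^ 3) (hF₁ : Fs 1 = X 2 ^ 2 + X 5 ^ 3 + X 3 ^ 7 + X 4 ^ 8 + X 0 ^ 12)
    (Gs : Fin 1 → MvPolynomial (Fin 5) k) (hG : Gs 0 = X 2 ^ 2 + (X 1 ^ 2 + X 0 ^ 3) ^ 3 + X 3 ^ 7 + X 4 ^ 8 + X 0 ^ 12)
    (h𝔪H : (Ideal.span (Set.range fun i : Fin 5 => Ideal.Quotient.mk (Ideal.span (Set.range Gs)) (MvPolynomial.X i))).IsMaximal)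
    (h𝔪CI : (Ideal.span (Set.range fun i : Fin 6 => Ideal.Quotient.mk (Ideal.span (Set.range Fs)) (MvPolynomial.X i))).IsMaximal)
    (h0 : ∃ (nc : ℕ) (c : Fin nc → (Spec (.of (MvPolynomial (Fin 5) k ⧸ Ideal.span (Set.range Gs)))).presheaf.stalk (⟨Ideal.span (Set.range fun i : Fin 5 => Ideal.Quotient.mk (Ideal.span (Set.range Gs)) (MvPolynomial.X i)), h𝔪H.isPrime⟩ : PrimeSpectrum (MvPolynomial (Fin 5) k ⧸ Ideal.span (Set.range Gs)))), Ideal.span (Set.range c) ≠ ⊥ ∧ (Ideal.span (Set.range c)).radical = IsLocalRing.maximalIdeal ((Spec (.of (MvPolynomial (Fin 5) k ⧸ Ideal.span (Set.range Gs)))).presheaf.stalk (⟨Ideal.span (Set.range fun i : Fin 5 => Ideal.Quotient.mk (Ideal.span (Set.range Gs)) (MvPolynomial.X i)), h𝔪H.isPrime⟩ : PrimeSpectrum (MvPolynomial (Fin 5) k ⧸ Ideal.span (Set.range Gs)))) ∧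
        ∀ (j : Fin nc) (𝔔 : PrimeSpectrum (Literature.AlgebraicGeometry.Resolution.blowupAlgebra (Ideal.span (Set.range c)) (c j))),
          𝔔.asIdeal.comap (algebraMap ((Spec (.of (MvPolynomial (Fin 5) k ⧸ Ideal.span (Set.range Gs)))).presheaf.stalk (⟨Ideal.span (Set.range fun i : Fin 5 => Ideal.Quotient.mk (Ideal.span (Set.range Gs)) (MvPolynomial.X i)), h𝔪H.isPrime⟩ : PrimeSpectrum (MvPolynomial (Fin 5) k ⧸ Ideal.span (Set.range Gs)))) (Literature.AlgebraicGeometry.Resolution.blowupAlgebra (Ideal.span (Set.range c)) (c j))) = IsLocalRing.maximalIdeal ((Spec (.of (MvPolynomial (Fin 5) k ⧸ Ideal.span (Set.range Gs)))).presheaf.stalk (⟨Ideal.span (Set.range fun i : Fin 5 => Ideal.Quotient.mk (Ideal.span (Set.range Gs)) (MvPolynomial.X i)), h𝔪H.isPrime⟩ : PrimeSpectrum (MvPolynomial (Fin 5) k ⧸ Ideal.span (Set.range Gs)))) →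
          IsDomain (Localization.AtPrime 𝔔.asIdeal) ∧ ∀ d : ℕ, ringKrullDim (Localization.AtPrime 𝔔.asIdeal) = d → ∀ s : Fin d → Localization.AtPrime 𝔔.asIdeal, (Ideal.span (Set.range s)).radical.IsMaximal → RingTheory.Sequence.IsWeaklyRegular (Localization.AtPrime 𝔔.asIdeal) (List.ofFn s) ∧ ∀ y : Localization.AtPrime 𝔔.asIdeal, (∃ e : ℕ, y ^ p ^ e ∈ Ideal.span ((fun z : Localization.AtPrime 𝔔.asIdeal => z ^ p ^ e) '' (Ideal.span (Set.range s) : Set (Localization.AtPrime 𝔔.asIdeal)))) → y ∈ Ideal.span (Set.range s)) :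
    (∃ (nc : ℕ) (c : Fin nc → (Spec (.of (MvPolynomial (Fin 6) k ⧸ Ideal.span (Set.range Fs)))).presheaf.stalk (⟨Ideal.span (Set.range fun i : Fin 6 => Ideal.Quotient.mk (Ideal.span (Set.range Fs)) (MvPolynomial.X i)), h𝔪CI.isPrime⟩ : PrimeSpectrum (MvPolynomial (Fin 6) k ⧸ Ideal.span (Set.range Fs)))), Ideal.span (Set.range c) ≠ ⊥ ∧ (Ideal.span (Set.range c)).radical = IsLocalRing.maximalIdeal ((Spec (.of (MvPolynomial (Fin 6) k ⧸ Ideal.span (Set.range Fs)))).presheaf.stalk (⟨Ideal.span (Set.range fun i : Fin 6 => Ideal.Quotient.mk (Ideal.span (Set.range Fs)) (MvPolynomial.X i)), h𝔪CI.isPrime⟩ : PrimeSpectrum (MvPolynomial (Fin 6) k ⧸ Ideal.span (Set.range Fs)))) ∧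
        ∀ (j : Fin nc) (𝔔 : PrimeSpectrum (Literature.AlgebraicGeometry.Resolution.blowupAlgebra (Ideal.span (Set.range c)) (c j))),
          𝔔.asIdeal.comap (algebraMap ((Spec (.of (MvPolynomial (Fin 6) k ⧸ Ideal.span (Set.range Fs)))).presheaf.stalk (⟨Ideal.span (Set.range fun i : Fin 6 => Ideal.Quotient.mk (Ideal.span (Set.range Fs)) (MvPolynomial.X i)), h𝔪CI.isPrime⟩ : PrimeSpectrum (MvPolynomial (Fin 6) k ⧸ Ideal.span (Set.range Fs)))) (Literature.AlgebraicGeometry.Resolution.blowupAlgebra (Ideal.span (Set.range c)) (c j))) = IsLocalRing.maximalIdeal ((Spec (.of (MvPolynomial (Fin 6) k ⧸ Ideal.span (Set.range Fs)))).presheaf.stalk (⟨Ideal.span (Set.range fun i : Fin 6 => Ideal.Quotient.mk (Ideal.span (Set.range Fs)) (MvPolynomial.X i)), h𝔪CI.isPrime⟩ : PrimeSpectrum (MvPolynomial (Fin 6) k ⧸ Ideal.span (Set.range Fs)))) →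
          IsDomain (Localization.AtPrime 𝔔.asIdeal) ∧ ∀ d : ℕ, ringKrullDim (Localization.AtPrime 𝔔.asIdeal) = d → ∀ s : Fin d → Localization.AtPrime 𝔔.asIdeal, (Ideal.span (Set.range s)).radical.IsMaximal → RingTheory.Sequence.IsWeaklyRegular (Localization.AtPrime 𝔔.asIdeal) (List.ofFn s) ∧ ∀ y : Localization.AtPrime 𝔔.asIdeal, (∃ e : ℕ, y ^ p ^ e ∈ Ideal.span ((fun z : Localization.AtPrime 𝔔.asIdeal => z ^ p ^ e) '' (Ideal.span (Set.range s) : Set (Localization.AtPrime 𝔔.asIdeal)))) → y ∈ Ideal.span (Set.range s)) := by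
  exact (nonempty_originStalk_ringEquiv k Fs hF₀ hF₁ Gs hG h𝔪CI h𝔪H).elim fun E =>
    PointFixableTransport.pointFixable_of_ringEquiv p E.symm h0

/-- **THE DOOR'S `h0` FROM THE LOCALISATION FORM**: from `PFix(Localization.AtPrime 𝔪_{T⁽⁴⁾,0})` on the hypersurface model to the
hypothesis `h0` of `T4SpecimenDoor.fInjectiveMacaulayfication_T4plus_char7` VERBATIM (`∀ b`, `b.asIdeal =` the origin ideal of `T⁽⁴⁾⁺`
`→ PFix(𝒪_{Spec, b})`), any field, any `p` (the door instantiates `p := 7`). [folklore] -/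
theorem t4Plus_h0_of_localization (p : ℕ) (Fs : Fin 2 → MvPolynomial (Fin 6) k)
    (hF₀ : Fs 0 = X 5 - X 1 ^ 2 - X 0 ^ 3) (hF₁ : Fs 1 = X 2 ^ 2 + X 5 ^ 3 + X 3 ^ 7 + X 4 ^ 8 + X 0 ^ 12)
    (Gs : Fin 1 → MvPolynomial (Fin 5) k) (hG : Gs 0 = X 2 ^ 2 + (X 1 ^ 2 + X 0 ^ 3) ^ 3 + X 3 ^ 7 + X 4 ^ 8 + X 0 ^ 12)
    [hH : (Ideal.span (Set.range fun i : Fin 5 => Ideal.Quotient.mk (Ideal.span (Set.range Gs)) (MvPolynomial.X i))).IsPrime]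
    (hPF : ∃ (nc : ℕ) (c : Fin nc → Localization.AtPrime (Ideal.span (Set.range fun i : Fin 5 => Ideal.Quotient.mk (Ideal.span (Set.range Gs)) (MvPolynomial.X i)))), Ideal.span (Set.range c) ≠ ⊥ ∧ (Ideal.span (Set.range c)).radical = IsLocalRing.maximalIdeal (Localization.AtPrime (Ideal.span (Set.range fun i : Fin 5 => Ideal.Quotient.mk (Ideal.span (Set.range Gs)) (MvPolynomial.X i)))) ∧
        ∀ (j : Fin nc) (𝔔 : PrimeSpectrum (Literature.AlgebraicGeometry.Resolution.blowupAlgebra (Ideal.span (Set.range c)) (c j))),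
          𝔔.asIdeal.comap (algebraMap (Localization.AtPrime (Ideal.span (Set.range fun i : Fin 5 => Ideal.Quotient.mk (Ideal.span (Set.range Gs)) (MvPolynomial.X i)))) (Literature.AlgebraicGeometry.Resolution.blowupAlgebra (Ideal.span (Set.range c)) (c j))) = IsLocalRing.maximalIdeal (Localization.AtPrime (Ideal.span (Set.range fun i : Fin 5 => Ideal.Quotient.mk (Ideal.span (Set.range Gs)) (MvPolynomial.X i)))) →
          IsDomain (Localization.AtPrime 𝔔.asIdeal) ∧ ∀ d : ℕ, ringKrullDim (Localization.AtPrime 𝔔.asIdeal) = d → ∀ s : Fin d → Localization.AtPrime 𝔔.asIdeal, (Ideal.span (Set.range s)).radical.IsMaximal → RingTheory.Sequence.IsWeaklyRegular (Localization.AtPrime 𝔔.asIdeal) (List.ofFn s) ∧ ∀ y : Localization.AtPrime 𝔔.asIdeal, (∃ e : ℕ, y ^ p ^ e ∈ Ideal.span ((fun z : Localization.AtPrime 𝔔.asIdeal => z ^ p ^ e) '' (Ideal.span (Set.range s) : Set (Localization.AtPrime 𝔔.asIdeal)))) → y ∈ Ideal.span (Set.range s)) :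
    ∀ b : ↥(Spec (.of (MvPolynomial (Fin 6) k ⧸ Ideal.span (Set.range Fs)))),
      b.asIdeal = Ideal.span (Set.range fun j : Fin 6 => Ideal.Quotient.mk (Ideal.span (Set.range Fs)) (MvPolynomial.X j)) →
    (∃ (nc : ℕ) (c : Fin nc → (Spec (.of (MvPolynomial (Fin 6) k ⧸ Ideal.span (Set.range Fs)))).presheaf.stalk b), Ideal.span (Set.range c) ≠ ⊥ ∧ (Ideal.span (Set.range c)).radical = IsLocalRing.maximalIdeal ((Spec (.of (MvPolynomial (Fin 6) k ⧸ Ideal.span (Set.range Fs)))).presheaf.stalk b) ∧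
        ∀ (j : Fin nc) (𝔔 : PrimeSpectrum (Literature.AlgebraicGeometry.Resolution.blowupAlgebra (Ideal.span (Set.range c)) (c j))),
          𝔔.asIdeal.comap (algebraMap ((Spec (.of (MvPolynomial (Fin 6) k ⧸ Ideal.span (Set.range Fs)))).presheaf.stalk b) (Literature.AlgebraicGeometry.Resolution.blowupAlgebra (Ideal.span (Set.range c)) (c j))) = IsLocalRing.maximalIdeal ((Spec (.of (MvPolynomial (Fin 6) k ⧸ Ideal.span (Set.range Fs)))).presheaf.stalk b) →
          IsDomain (Localization.AtPrime 𝔔.asIdeal) ∧ ∀ d : ℕ, ringKrullDim (Localization.AtPrime 𝔔.asIdeal) = d → ∀ s : Fin d → Localization.AtPrime 𝔔.asIdeal, (Ideal.span (Set.range s)).radical.IsMaximal → RingTheory.Sequence.IsWeaklyRegular (Localization.AtPrime 𝔔.asIdeal) (List.ofFn s) ∧ ∀ y : Localization.AtPrime 𝔔.asIdeal, (∃ e : ℕ, y ^ p ^ e ∈ Ideal.span ((fun z : Localization.AtPrime 𝔔.asIdeal => z ^ p ^ e) '' (Ideal.span (Set.range s) : Set (Localization.AtPrime 𝔔.asIdeal))))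 → y ∈ Ideal.span (Set.range s)) := by
  intro b hb
  haveI hCI : (Ideal.span (Set.range fun j : Fin 6 => Ideal.Quotient.mk (Ideal.span (Set.range Fs)) (MvPolynomial.X j))).IsPrime :=
    hb ▸ b.isPrime
  haveI := b.isPrime
  -- `(T⁽⁴⁾⁺)_𝔪 ≅ (T⁽⁴⁾⁺)_b` along the identity (`b.asIdeal = 𝔪`), then the stalk
  have e_b := BlowupFiModelOfCover.nonempty_ringEquiv_localization_of_ringEquiv
    (RingEquiv.refl (MvPolynomial (Fin 6) k ⧸ Ideal.span (Set.range Fs)))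
    (Ideal.span (Set.range fun j : Fin 6 => Ideal.Quotient.mk (Ideal.span (Set.range Fs)) (MvPolynomial.X j))) b.asIdeal
    (fun x => by rw [hb]; exact Iff.rfl)
  refine (nonempty_originLocalization_ringEquiv k Fs hF₀ hF₁ Gs hG).elim fun eL => e_b.elim fun eb => ?_
  have h1 := PointFixableTransport.pointFixable_of_ringEquiv p
    (O := Localization.AtPrime (Ideal.span (Set.range fun i : Fin 5 => Ideal.Quotient.mk (Ideal.span (Set.range Gs)) (MvPolynomial.X i))))
    (O' := Localization.AtPrime (Ideal.span (Set.range fun j : Fin 6 => Ideal.Quotient.mk (Ideal.span (Set.range Fs)) (MvPolynomial.X j))))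
    eL.symm hPF
  have h2 := PointFixableTransport.pointFixable_of_ringEquiv p
    (O := Localization.AtPrime (Ideal.span (Set.range fun j : Fin 6 => Ideal.Quotient.mk (Ideal.span (Set.range Fs)) (MvPolynomial.X j))))
    (O' := Localization.AtPrime b.asIdeal) eb h1
  exact PointFixableTransport.pointFixable_of_ringEquiv p (O := Localization.AtPrime b.asIdeal)
    (O' := ↥((Spec (.of (MvPolynomial (Fin 6) k ⧸ Ideal.span (Set.range Fs)))).presheaf.stalk b))
    (Spec.stalkIso (.of (MvPolynomial (Fin 6) k ⧸ Ideal.span (Set.range Fs))) b).commRingCatIsoToRingEquiv.symm h2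

/-- **(3′) `h0(T⁽⁴⁾)` (stalk form, road-B frame output at `n = 5`) ⟹ `h0(T⁽⁴⁾⁺)` (the specimen door's hypothesis)**, any field `k`,
any `p`; the origin ideal of the hypersurface model is assumed prime (instance binder; `QuotientOriginMaximal.isMaximal_span_range_mk_X` or
`T4HypersurfacePrime` + maximality supply it). [folklore] -/
theorem t4Plus_h0_of_hypersurface_h0 (p : ℕ) (Fs : Fin 2 → MvPolynomial (Fin 6) k)
    (hF₀ : Fs 0 = X 5 - X 1 ^ 2 - X 0 ^ 3) (hF₁ : Fs 1 = X 2 ^ 2 + X 5 ^ 3 + X 3 ^ 7 + X 4 ^ 8 + X 0 ^ 12)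
    (Gs : Fin 1 → MvPolynomial (Fin 5) k) (hG : Gs 0 = X 2 ^ 2 + (X 1 ^ 2 + X 0 ^ 3) ^ 3 + X 3 ^ 7 + X 4 ^ 8 + X 0 ^ 12)
    [hH : (Ideal.span (Set.range fun j : Fin 5 => Ideal.Quotient.mk (Ideal.span (Set.range Gs)) (MvPolynomial.X j))).IsPrime]
    (h : ∀ b : ↥(Spec (.of (MvPolynomial (Fin 5) k ⧸ Ideal.span (Set.range Gs)))),
      b.asIdeal = Ideal.span (Set.range fun j : Fin 5 => Ideal.Quotient.mk (Ideal.span (Set.range Gs)) (MvPolynomial.X j)) →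
      (∃ (nc : ℕ) (c : Fin nc → (Spec (.of (MvPolynomial (Fin 5) k ⧸ Ideal.span (Set.range Gs)))).presheaf.stalk b), Ideal.span (Set.range c) ≠ ⊥ ∧ (Ideal.span (Set.range c)).radical = IsLocalRing.maximalIdeal ((Spec (.of (MvPolynomial (Fin 5) k ⧸ Ideal.span (Set.range Gs)))).presheaf.stalk b) ∧
        ∀ (j : Fin nc) (𝔔 : PrimeSpectrum (Literature.AlgebraicGeometry.Resolution.blowupAlgebra (Ideal.span (Set.range c)) (c j))),
          𝔔.asIdeal.comap (algebraMap ((Spec (.of (MvPolynomial (Fin 5) k ⧸ Ideal.span (Set.range Gs)))).presheaf.stalk b) (Literature.AlgebraicGeometry.Resolution.blowupAlgebra (Ideal.span (Set.range c)) (c j))) = IsLocalRing.maximalIdeal ((Spec (.of (MvPolynomial (Fin 5) k ⧸ Ideal.span (Set.range Gs)))).presheaf.stalk b) →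
          IsDomain (Localization.AtPrime 𝔔.asIdeal) ∧ ∀ d : ℕ, ringKrullDim (Localization.AtPrime 𝔔.asIdeal) = d → ∀ s : Fin d → Localization.AtPrime 𝔔.asIdeal, (Ideal.span (Set.range s)).radical.IsMaximal → RingTheory.Sequence.IsWeaklyRegular (Localization.AtPrime 𝔔.asIdeal) (List.ofFn s) ∧ ∀ y : Localization.AtPrime 𝔔.asIdeal, (∃ e : ℕ, y ^ p ^ e ∈ Ideal.span ((fun z : Localization.AtPrime 𝔔.asIdeal => z ^ p ^ e) '' (Ideal.span (Set.range s) : Set (Localization.AtPrime 𝔔.asIdeal)))) → y ∈ Ideal.span (Set.range s))) :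
    ∀ b : ↥(Spec (.of (MvPolynomial (Fin 6) k ⧸ Ideal.span (Set.range Fs)))),
      b.asIdeal = Ideal.span (Set.range fun j : Fin 6 => Ideal.Quotient.mk (Ideal.span (Set.range Fs)) (MvPolynomial.X j)) →
    (∃ (nc : ℕ) (c : Fin nc → (Spec (.of (MvPolynomial (Fin 6) k ⧸ Ideal.span (Set.range Fs)))).presheaf.stalk b), Ideal.span (Set.range c) ≠ ⊥ ∧ (Ideal.span (Set.range c)).radical = IsLocalRing.maximalIdeal ((Spec (.of (MvPolynomial (Fin 6) k ⧸ Ideal.span (Set.range Fs)))).presheaf.stalk b) ∧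
        ∀ (j : Fin nc) (𝔔 : PrimeSpectrum (Literature.AlgebraicGeometry.Resolution.blowupAlgebra (Ideal.span (Set.range c)) (c j))),
          𝔔.asIdeal.comap (algebraMap ((Spec (.of (MvPolynomial (Fin 6) k ⧸ Ideal.span (Set.range Fs)))).presheaf.stalk b) (Literature.AlgebraicGeometry.Resolution.blowupAlgebra (Ideal.span (Set.range c)) (c j))) = IsLocalRing.maximalIdeal ((Spec (.of (MvPolynomial (Fin 6) k ⧸ Ideal.span (Set.range Fs)))).presheaf.stalk b) →
          IsDomain (Localization.AtPrime 𝔔.asIdeal) ∧ ∀ d : ℕ, ringKrullDim (Localization.AtPrime 𝔔.asIdeal) = d → ∀ s : Fin d → Localization.AtPrime 𝔔.asIdeal, (Ideal.span (Set.range s)).radical.IsMaximal → RingTheory.Sequence.IsWeaklyRegular (Localization.AtPrime 𝔔.asIdeal) (List.ofFn s) ∧ ∀ y : Localization.AtPrime 𝔔.asIdeal, (∃ e : ℕ, y ^ p ^ e ∈ Ideal.span ((fun z : Localization.AtPrime 𝔔.asIdeal => z ^ p ^ e) '' (Ideal.span (Set.range s) : Set (Localization.AtPrime 𝔔.asIdeal))))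 → y ∈ Ideal.span (Set.range s)) := by
  -- the origin `b_H` of the hypersurface model and `PFix(𝒪_{b_H})`
  let bH : ↥(Spec (.of (MvPolynomial (Fin 5) k ⧸ Ideal.span (Set.range Gs)))) :=
    ⟨Ideal.span (Set.range fun j : Fin 5 => Ideal.Quotient.mk (Ideal.span (Set.range Gs)) (MvPolynomial.X j)), hH⟩
  have hbH := h bH rfl
  -- move it to the localisation `k[X]/(Gs)_𝔪`
  have hPF := PointFixableTransport.pointFixable_of_ringEquiv p
    (O := ↥((Spec (.of (MvPolynomial (Fin 5) k ⧸ Ideal.span (Set.range Gs)))).presheaf.stalk bH))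
    (O' := Localization.AtPrime (Ideal.span (Set.range fun j : Fin 5 => Ideal.Quotient.mk (Ideal.span (Set.range Gs)) (MvPolynomial.X j))))
    (Spec.stalkIso (.of (MvPolynomial (Fin 5) k ⧸ Ideal.span (Set.range Gs))) bH).commRingCatIsoToRingEquiv hbH
  -- and conclude with the localisation-form bridge
  exact t4Plus_h0_of_localization k p Fs hF₀ hF₁ Gs hG hPF

/-! ## Assembly endpoint: the road-B frame's output on `T⁽⁴⁾` gives the crux conclusion for `T⁽⁴⁾⁺/7` -/

/-- **THE CRUX CONCLUSION FOR `T⁽⁴⁾⁺` IN CHARACTERISTIC `7` FROM THE ROAD-B FRAME'S STALK-FORM OUTPUT ON THE HYPERSURFACE `T⁽⁴⁾ = V(g) ⊂ 𝔸⁵`**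
(`h_frame` = the conclusion of `RoadBFrame.originPointFixable_of_hon` VERBATIM at `n = 5`, `f := g`, `p := 7`): composition of
`t4Plus_h0_of_hypersurface_h0` with the specimen door `T4SpecimenDoor.fInjectiveMacaulayfication_T4plus_char7` (stub-4, p520610); the
instance «origin of `k[x,y,z,w,v]/(g)` is prime» comes from `QuotientOriginMaximal.isMaximal_span_range_mk_X` (`g(0) = 0`). What remains
for the unconditional `T⁽⁴⁾⁺/7` theorem is exactly `h_frame` (the T⁽⁴⁾/7 fan + cells campaign). [folklore] -/
theorem fInjectiveMacaulayfication_T4plus_char7_of_frame [CharP k 7] (Fs : Fin 2 → MvPolynomial (Fin 6) k)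
    (hF₀ : Fs 0 = X 5 - X 1 ^ 2 - X 0 ^ 3) (hF₁ : Fs 1 = X 2 ^ 2 + X 5 ^ 3 + X 3 ^ 7 + X 4 ^ 8 + X 0 ^ 12)
    (g : MvPolynomial (Fin 5) k) (hg : g = X 2 ^ 2 + (X 1 ^ 2 + X 0 ^ 3) ^ 3 + X 3 ^ 7 + X 4 ^ 8 + X 0 ^ 12)
    (h_frame : ∀ b : Spec (.of (MvPolynomial (Fin 5) k ⧸ Ideal.span (Set.range (![g] : Fin 1 → MvPolynomial (Fin 5) k)))),
      b.asIdeal = Ideal.span (Set.range fun j : Fin 5 =>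
        Ideal.Quotient.mk (Ideal.span (Set.range (![g] : Fin 1 → MvPolynomial (Fin 5) k))) (X j)) →
      ∃ (nc : ℕ) (c : Fin nc → (Spec (.of (MvPolynomial (Fin 5) k ⧸ Ideal.span (Set.range (![g] : Fin 1 → MvPolynomial (Fin 5) k))))).presheaf.stalk b),
        Ideal.span (Set.range c) ≠ ⊥ ∧ (Ideal.span (Set.range c)).radical =
          IsLocalRing.maximalIdeal ((Spec (.of (MvPolynomial (Fin 5) k ⧸ Ideal.span (Set.range (![g] : Fin 1 → MvPolynomial (Fin 5) k))))).presheaf.stalk b) ∧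
        ∀ (j : Fin nc) (𝔔 : PrimeSpectrum (Literature.AlgebraicGeometry.Resolution.blowupAlgebra (Ideal.span (Set.range c)) (c j))),
          𝔔.asIdeal.comap (algebraMap ((Spec (.of (MvPolynomial (Fin 5) k ⧸ Ideal.span (Set.range (![g] : Fin 1 → MvPolynomial (Fin 5) k))))).presheaf.stalk b)
            (Literature.AlgebraicGeometry.Resolution.blowupAlgebra (Ideal.span (Set.range c)) (c j))) =
            IsLocalRing.maximalIdeal ((Spec (.of (MvPolynomial (Fin 5) k ⧸ Ideal.span (Set.range (![g] : Fin 1 → MvPolynomial (Fin 5) k))))).presheaf.stalk b) →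
          IsDomain (Localization.AtPrime 𝔔.asIdeal) ∧ ∀ dd : ℕ, ringKrullDim (Localization.AtPrime 𝔔.asIdeal) = dd →
            ∀ s : Fin dd → Localization.AtPrime 𝔔.asIdeal, (Ideal.span (Set.range s)).radical.IsMaximal →
              RingTheory.Sequence.IsWeaklyRegular (Localization.AtPrime 𝔔.asIdeal) (List.ofFn s) ∧
              ∀ y : Localization.AtPrime 𝔔.asIdeal, (∃ e : ℕ, y ^ 7 ^ e ∈ Ideal.span
                ((fun z : Localization.AtPrime 𝔔.asIdeal => z ^ 7 ^ e) '' (Ideal.span (Set.range s) : Set (Localization.AtPrime 𝔔.asIdeal)))) →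
                y ∈ Ideal.span (Set.range s)) :
    ∃ (X' : Scheme.{0}) (π : X' ⟶ (Spec (.of (MvPolynomial (Fin 6) k ⧸ Ideal.span (Set.range Fs))))), IsProper π ∧
      Literature.AlgebraicGeometry.Resolution.IsBirational π ∧
      ∀ x : X', IsDomain (X'.presheaf.stalk x) ∧ ∀ d : ℕ, ringKrullDim (X'.presheaf.stalk x) = d →
        ∀ s : Fin d → X'.presheaf.stalk x, (Ideal.span (Set.range s)).radical.IsMaximal →
          RingTheory.Sequence.IsWeaklyRegular (X'.presheaf.stalk x) (List.ofFn s) ∧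
          ∀ y : X'.presheaf.stalk x, (∃ e : ℕ, y ^ 7 ^ e ∈
            Ideal.span ((fun z : X'.presheaf.stalk x => z ^ 7 ^ e) '' (Ideal.span (Set.range s) : Set (X'.presheaf.stalk x)))) →
            y ∈ Ideal.span (Set.range s) := by
  haveI : (Ideal.span (Set.range fun j : Fin 5 =>
      Ideal.Quotient.mk (Ideal.span (Set.range (![g] : Fin 1 → MvPolynomial (Fin 5) k))) (MvPolynomial.X j))).IsPrime :=
    (QuotientOriginMaximal.isMaximal_span_range_mk_X k (![g] : Fin 1 → MvPolynomial (Fin 5) k) (fun l => by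
      fin_cases l; subst hg; simp [constantCoeff_X])).isPrime
  exact T4SpecimenDoor.fInjectiveMacaulayfication_T4plus_char7 k Fs hF₀ hF₁
    (t4Plus_h0_of_hypersurface_h0 k 7 Fs hF₀ hF₁ ![g] hg h_frame)

end Summit.ResolutionOfSingularities.ResolutionOfSingularities.Theorems.FInjectiveMacaulayfication.T4PlusOriginTransport

end
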